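import Summits.ValiantsHypothesis.ValiantsHypothesis.Theorems.BarrierLeverChowBenchmarkPairsBlockPeelRows
import Summits.ValiantsHypothesis.ValiantsHypothesis.Theorems.BarrierLeverPartitionMinorsMooreBenchStage

/-!
# Route BarrierLever — item 22038 `ChowBenchmarkPairs`, line `moore-peel`: the BLOCK PEEL, II — cancellable
# recombination of a block indexed by any finite type, block / external row labels inside `stageRows i (n+t)`,
# and the reduced rows `kblockReducedRow` of a tied block

Helper file (`--supports stmt-ValiantsHypothesis-22038`; cell valiant-natproofs, rung V4, 𝒟-side benchmark of
record, line `moore_peel`, planner kernel target **K1** (HOME/STATUS.md l.1746); seat val-np-p4 gen 29).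
Closes NO item.  Three auxiliary definitions (`blockLabel`, `extLabel`, `kblockReducedRow`) and their API; the
`t`-point analogue of the bookkeeping half of `…KernelPeelStage` (memo `HOME/val-np-p4/g28/memo/MEMO-valnp4-g28.md`
§1).  The stage reduction itself is `…BlockPeelStage`.

At stage `(i, n+t)` the LAST `t` points `n, …, n+t-1` are peeled together.  The rows alive split into
* the FIXED rows (alive at stage `(i, n)`),
* the BLOCK rows `blockLabel i n ρ`, `ρ : BlockIdx i t` (attached rows `(T_q, {n+s})`, `q < i`, and internal
  pair rows `(n+s'', n+s)`, `s'' < s < t`),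
* the EXTERNAL pair rows `extLabel n (c, s) = (c, n+s)`, `c < n`, `s < t`  (`stageRows_trichotomy`).

* `linearIndependent_of_block'` — `linearIndependent_of_block` of `…MooreBenchToolkit` with the block indexed by
  an arbitrary finite type (used with `BlockIdx i t` and with `Fin n × Fin t`).
* `kblockReducedRow κ r i n Y` — the reduced rows: fixed rows are the constants `C ∘ krow κ r Y x`; a block row
  becomes `col ↦ [c_i ≤ col] · C(blockEntry κ i (fun s => Y (n+s)) ρ col) · X^col`
  (`kblockReducedRow_blockLabel`); an external row `(c, n+s)` becomes
  `col ↦ Σ_{d ⊆ T_col, bin d ≥ i} C(κ|T∖d| (Y c)^{bin(T∖d)} κ|d| (Y (n+s))^{bin d}) · X^{bin d}`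
  (`kblockReducedRow_extLabel`).

WHAT THIS IS NOT: no stub of line `moore_peel` is closed; `stub_segmentMeanValue` (∀ h) is untouched; nothing
on crux stmt-ValiantsHypothesis-14610 or on `VP` versus `VNP`.
-/

set_option linter.dupNamespace false

namespace Summit.ValiantsHypothesis.ValiantsHypothesis.Theorems.BarrierLever.MoorePeel

open Polynomial Finset

/-! ## 1. Cancellable recombination of a block indexed by a finite type -/

/-- **Cancellable recombination of a block of rows** (`linearIndependent_of_block` with the block indexed by an
arbitrary finite type `κι`).  Let `ι : κι → K` be injective and let `u` agree with `v` off the image of `ι`,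
while on the image `u (ι j') = Σ_j N j' j • v (ι j)` for a matrix `N` admitting `N'` with `N' * N = D • 1`,
`D` a non-zero-divisor.  If `u` is linearly independent then so is `v`. -/
theorem linearIndependent_of_block' {S : Type*} [CommRing S] {M : Type*} [AddCommGroup M] [Module S M]
    {K : Type*} [Fintype K] [DecidableEq K] {κι : Type*} [Fintype κι] [DecidableEq κι]
    (v u : K → M) (ι : κι → K) (hι : Function.Injective ι) (N N' : Matrix κι κι S) (D : S)
    (hD : ∀ x : S, D * x = 0 → x = 0) (hNN : N' * N = D • (1 : Matrix κι κι S))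
    (hon : ∀ j', u (ι j') = ∑ j, N j' j • v (ι j)) (hoff : ∀ x, x ∉ Set.range ι → u x = v x)
    (hu : LinearIndependent S u) : LinearIndependent S v := by
  rw [Fintype.linearIndependent_iff] at hu ⊢
  intro g hg
  set c : κι → S := fun j' => ∑ l, g (ι l) * N' l j' with hc
  set g'' : K → S := fun x =>
    (if x ∈ Set.range ι then 0 else D * g x) + ∑ j', if ι j' = x then c j' else 0 with hg''
  have hsplit : ∀ f : K → M, ∑ x, f x =
      ∑ j, f (ι j) + ∑ x ∈ Finset.univ.filter (fun x => x ∉ Set.range ι), f x := by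
    intro f
    rw [← Finset.sum_filter_add_sum_filter_not Finset.univ (fun x => x ∈ Set.range ι)]
    congr 1
    have himage : Finset.univ.filter (fun x => x ∈ Set.range ι) = Finset.univ.image ι := by
      ext x
      simp [Set.mem_range, eq_comm]
    rw [himage, Finset.sum_image fun a _ b _ e => hι e]
  have hcN : ∀ j, ∑ j', c j' * N j' j = D * g (ι j) := by
    intro j
    have e : ∀ j', c j' * N j' j = ∑ l, g (ι l) * (N' l j' * N j' j) := fun j' => by
      rw [hc, Finset.sum_mul]
      exact Finset.sum_congr rfl fun l _ => by ring
    rw [Finset.sum_congr rfl fun j' _ => e j', Finset.sum_comm]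
    have e2 : ∀ l, ∑ j', g (ι l) * (N' l j' * N j' j) = g (ι l) * (N' * N) l j := fun l => by
      rw [Matrix.mul_apply, Finset.mul_sum]
    rw [Finset.sum_congr rfl fun l _ => e2 l, hNN]
    simp only [Matrix.smul_apply, Matrix.one_apply, smul_eq_mul, mul_ite, mul_one, mul_zero]
    rw [Finset.sum_ite_eq' Finset.univ j]
    simp [mul_comm]
  have hblock_val : ∀ j₀, g'' (ι j₀) = c j₀ := by
    intro j₀
    rw [hg'']
    simp only [Set.mem_range_self, if_true, zero_add, hι.eq_iff]
    rw [Finset.sum_ite_eq' Finset.univ j₀]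
    simp
  have hoff_val : ∀ x, x ∉ Set.range ι → g'' x = D * g x := by
    intro x hx
    rw [hg'']
    simp only [hx, if_false]
    rw [Finset.sum_eq_zero (fun j' _ => if_neg (fun e => hx ⟨j', e⟩)), add_zero]
  have key : ∑ x, g'' x • u x = 0 := by
    rw [hsplit (fun x => g'' x • u x)]
    have h1 : ∑ j, g'' (ι j) • u (ι j) = ∑ j, (D * g (ι j)) • v (ι j) := by
      simp_rw [hblock_val, hon, Finset.smul_sum, smul_smul]
      rw [Finset.sum_comm]
      refine Finset.sum_congr rfl fun j _ => ?_
      rw [← Finset.sum_smul, hcN]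
    have h2 : ∑ x ∈ Finset.univ.filter (fun x => x ∉ Set.range ι), g'' x • u x =
        ∑ x ∈ Finset.univ.filter (fun x => x ∉ Set.range ι), (D * g x) • v x := by
      refine Finset.sum_congr rfl fun x hx => ?_
      have hx' : x ∉ Set.range ι := (Finset.mem_filter.mp hx).2
      rw [hoff_val x hx', hoff x hx']
    rw [h1, h2]
    have h3 : ∑ x, (D * g x) • v x = D • ∑ x, g x • v x := by
      rw [Finset.smul_sum]
      exact Finset.sum_congr rfl fun x _ => by rw [mul_smul]
    rw [← hsplit (fun x => (D * g x) • v x), h3, hg, smul_zero]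
  have hz := hu g'' key
  have hc0 : ∀ j', c j' = 0 := fun j' => by rw [← hblock_val j']; exact hz (ι j')
  intro x
  by_cases hx : x ∈ Set.range ι
  · obtain ⟨j, rfl⟩ := hx
    apply hD
    rw [← hcN j]
    exact Finset.sum_eq_zero fun j' _ => by rw [hc0 j', zero_mul]
  · apply hD
    rw [← hoff_val x hx]
    exact hz x

/-! ## 2. Block labels and external labels inside `stageRows i (n+t)` -/

/-- The row label of the block row `ρ = ⟨s, q⟩` when the block starts at point `n`: the attached row
`(T_q, {n+s})` for `q < i`, the internal pair row `(n + (q-i), n+s)` for `q ≥ i`. -/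
def blockLabel (i n : ℕ) {t : ℕ} (ρ : BlockIdx i t) : RowLabel :=
  if (ρ.2 : ℕ) < i then Sum.inr (Sum.inl ((ρ.2 : ℕ), n + (ρ.1 : ℕ)))
  else Sum.inr (Sum.inr (n + ((ρ.2 : ℕ) - i), n + (ρ.1 : ℕ)))

/-- The row label of the external pair row `(c, n+s)`. -/
def extLabel (n : ℕ) {t : ℕ} (cs : Fin n × Fin t) : RowLabel :=
  Sum.inr (Sum.inr ((cs.1 : ℕ), n + (cs.2 : ℕ)))

section Labels

variable {i n t : ℕ}

/-- The block label of an attached row. -/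
theorem blockLabel_of_lt (ρ : BlockIdx i t) (hq : (ρ.2 : ℕ) < i) :
    blockLabel i n ρ = Sum.inr (Sum.inl ((ρ.2 : ℕ), n + (ρ.1 : ℕ))) := by
  rw [blockLabel, if_pos hq]

/-- The block label of an internal pair row. -/
theorem blockLabel_of_not_lt (ρ : BlockIdx i t) (hq : ¬ (ρ.2 : ℕ) < i) :
    blockLabel i n ρ = Sum.inr (Sum.inr (n + ((ρ.2 : ℕ) - i), n + (ρ.1 : ℕ))) := by
  rw [blockLabel, if_neg hq]

/-- Block rows are alive at stage `(i, n+t)`. -/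
theorem blockLabel_mem (ρ : BlockIdx i t) : blockLabel i n ρ ∈ stageRows i (n + t) := by
  have h1 := ρ.1.2
  have h2 := ρ.2.2
  by_cases hq : (ρ.2 : ℕ) < i
  · rw [blockLabel_of_lt ρ hq, inr_inl_mem_stageRows]
    exact ⟨hq, by omega⟩
  · rw [blockLabel_of_not_lt ρ hq, inr_inr_mem_stageRows]
    exact ⟨by omega, by omega⟩

/-- Block rows are not fixed rows. -/
theorem blockLabel_not_mem (ρ : BlockIdx i t) : blockLabel i n ρ ∉ stageRows i n := by
  by_cases hq : (ρ.2 : ℕ) < i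
  · rw [blockLabel_of_lt ρ hq, inr_inl_mem_stageRows]
    omega
  · rw [blockLabel_of_not_lt ρ hq, inr_inr_mem_stageRows]
    omega

/-- `blockLabel i n` is injective. -/
theorem blockLabel_injective : Function.Injective (blockLabel i n (t := t)) := by
  rintro ⟨s, q⟩ ⟨s', q'⟩ e
  have hq2 := q.2
  have hq'2 := q'.2
  by_cases hq : (q : ℕ) < i <;> by_cases hq' : (q' : ℕ) < i
  · rw [blockLabel_of_lt ⟨s, q⟩ hq, blockLabel_of_lt ⟨s', q'⟩ hq'] at e
    simp only [Sum.inr.injEq, Sum.inl.injEq, Prod.mk.injEq] at e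
    obtain ⟨e1, e2⟩ := e
    have hs : s = s' := Fin.ext (by omega)
    subst hs
    have hqq : q = q' := Fin.ext e1
    subst hqq
    rfl
  · rw [blockLabel_of_lt ⟨s, q⟩ hq, blockLabel_of_not_lt ⟨s', q'⟩ hq'] at e
    simp at e
  · rw [blockLabel_of_not_lt ⟨s, q⟩ hq, blockLabel_of_lt ⟨s', q'⟩ hq'] at e
    simp at e
  · rw [blockLabel_of_not_lt ⟨s, q⟩ hq, blockLabel_of_not_lt ⟨s', q'⟩ hq'] at e
    simp only [Sum.inr.injEq, Prod.mk.injEq] at e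
    obtain ⟨e1, e2⟩ := e
    have hs : s = s' := Fin.ext (by omega)
    subst hs
    have hqq : q = q' := Fin.ext (by omega)
    subst hqq
    rfl

/-- External rows are alive at stage `(i, n+t)`. -/
theorem extLabel_mem (cs : Fin n × Fin t) : extLabel n cs ∈ stageRows i (n + t) := by
  have h1 := cs.1.2
  have h2 := cs.2.2
  rw [extLabel, inr_inr_mem_stageRows]
  exact ⟨by omega, by omega⟩

/-- External rows are not fixed rows. -/
theorem extLabel_not_mem (cs : Fin n × Fin t) : extLabel n cs ∉ stageRows i n := by
  rw [extLabel, inr_inr_mem_stageRows]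
  omega

/-- `extLabel n` is injective. -/
theorem extLabel_injective : Function.Injective (extLabel n (t := t)) := by
  rintro ⟨c, s⟩ ⟨c', s'⟩ e
  simp only [extLabel, Sum.inr.injEq, Prod.mk.injEq] at e
  obtain ⟨e1, e2⟩ := e
  rw [Fin.ext e1, Fin.ext (by omega : (s : ℕ) = s')]

/-- External rows are not block rows. -/
theorem extLabel_ne_blockLabel (cs : Fin n × Fin t) (ρ : BlockIdx i t) : extLabel n cs ≠ blockLabel i n ρ := by
  have h1 := cs.1.2
  by_cases hq : (ρ.2 : ℕ) < i
  · rw [blockLabel_of_lt ρ hq, extLabel]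
    simp
  · rw [blockLabel_of_not_lt ρ hq, extLabel]
    simp only [Ne, Sum.inr.injEq, Prod.mk.injEq, not_and]
    intro e
    omega

/-- **Trichotomy.**  A row alive at stage `(i, n+t)` is fixed, a block row, or an external row. -/
theorem stageRows_trichotomy (x : RowLabel) (hx : x ∈ stageRows i (n + t)) :
    x ∈ stageRows i n ∨ (∃ ρ : BlockIdx i t, x = blockLabel i n ρ) ∨
      (∃ cs : Fin n × Fin t, x = extLabel n cs) := by
  rcases x with m | ⟨j, b⟩ | ⟨b, b'⟩
  · exact Or.inl (inl_mem_stageRows.mpr (inl_mem_stageRows.mp hx))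
  · obtain ⟨hj, hb⟩ := inr_inl_mem_stageRows.mp hx
    by_cases hbn : b < n
    · exact Or.inl (inr_inl_mem_stageRows.mpr ⟨hj, hbn⟩)
    · refine Or.inr (Or.inl ⟨⟨⟨b - n, by omega⟩, ⟨j, Nat.lt_of_lt_of_le hj (Nat.le_add_right _ _)⟩⟩, ?_⟩)
      rw [blockLabel_of_lt _ (by exact hj)]
      show Sum.inr (Sum.inl (j, b)) = Sum.inr (Sum.inl (j, n + (b - n)))
      rw [Nat.add_sub_cancel' (le_of_not_gt hbn)]
  · obtain ⟨hbb, hb'⟩ := inr_inr_mem_stageRows.mp hx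
    by_cases hb'n : b' < n
    · exact Or.inl (inr_inr_mem_stageRows.mpr ⟨hbb, hb'n⟩)
    · by_cases hbn : b < n
      · refine Or.inr (Or.inr ⟨(⟨b, hbn⟩, ⟨b' - n, by omega⟩), ?_⟩)
        show Sum.inr (Sum.inr (b, b')) = Sum.inr (Sum.inr (b, n + (b' - n)))
        rw [Nat.add_sub_cancel' (le_of_not_gt hb'n)]
      · have hq : i + (b - n) < i + (b' - n) := by omega
        refine Or.inr (Or.inl ⟨⟨⟨b' - n, by omega⟩, ⟨i + (b - n), hq⟩⟩, ?_⟩)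
        rw [blockLabel_of_not_lt _ (by show ¬ (i + (b - n) < i); omega)]
        show Sum.inr (Sum.inr (b, b')) = Sum.inr (Sum.inr (n + (i + (b - n) - i), n + (b' - n)))
        rw [Nat.add_sub_cancel_left, Nat.add_sub_cancel' (le_of_not_gt hbn),
          Nat.add_sub_cancel' (le_of_not_gt hb'n)]

end Labels

/-! ## 3. Stage reduction I: tied substitution, scaling and reduction against the fixed rows -/

/-- **The reduced kernel rows at stage `(i, n+t)`** after the tied substitution `Y_b ↦ (Y b)·X` (`n ≤ b`), the
scaling of the attached block rows `(T_q, {b})` by `X^q`, and the reduction against the fixed rows (see the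
module docstring for the closed forms). -/
noncomputable def kblockReducedRow {R : Type*} [CommRing R] (κ : ℕ → ℕ) (r i n : ℕ) (Y : ℕ → R) :
    RowLabel → (Fin r → R[X]) := fun x col =>
  Sum.elim (fun m => C (krow κ r Y (Sum.inl m) col))
    (Sum.elim
      (fun jb : ℕ × ℕ => if n ≤ jb.2 then
          (if (col : ℕ) < windowStart i then 0 else
            C (((kincl κ jb.1 (col : ℕ) : ℕ) : R) * Y jb.2 ^ ((col : ℕ) - jb.1)) * X ^ (col : ℕ))
        else C (krow κ r Y (Sum.inr (Sum.inl jb)) col))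
      (fun bb : ℕ × ℕ => if n ≤ bb.1 then
          (if (col : ℕ) < windowStart i then 0 else C (pairCoef κ (Y bb.1) (Y bb.2) (col : ℕ)) * X ^ (col : ℕ))
        else if n ≤ bb.2 then
          ∑ d ∈ (bits (col : ℕ)).powerset.filter (fun d => i ≤ bin d),
            C ((((κ (bits (col : ℕ) \ d).card : ℕ) : R)) * Y bb.1 ^ bin (bits (col : ℕ) \ d) *
              (((κ d.card : ℕ) : R) * Y bb.2 ^ bin d)) * X ^ bin d
        else C (krow κ r Y (Sum.inr (Sum.inr bb)) col)))
    x

section Reduced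

variable {R : Type*} [CommRing R] (κ : ℕ → ℕ) (r i n : ℕ) {t : ℕ} (Y : ℕ → R)

/-- Reduced fixed rows are constants. -/
theorem kblockReducedRow_of_mem (x : RowLabel) (hx : x ∈ stageRows i n) :
    kblockReducedRow κ r i n Y x = fun col => C (krow κ r Y x col) := by
  funext col
  rcases x with m | ⟨j, b⟩ | ⟨b, b'⟩
  · rfl
  · have hb : ¬ n ≤ b := not_le.mpr (inr_inl_mem_stageRows.mp hx).2
    simp [kblockReducedRow, hb]
  · have hbb := inr_inr_mem_stageRows.mp hx
    have hb : ¬ n ≤ b := by omega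
    have hb' : ¬ n ≤ b' := by omega
    simp [kblockReducedRow, hb, hb']

/-- Reduced block rows: `col ↦ [c_i ≤ col] · C (blockEntry κ i (fun s => Y (n+s)) ρ col) · X^col`. -/
theorem kblockReducedRow_blockLabel (ρ : BlockIdx i t) :
    kblockReducedRow κ r i n Y (blockLabel i n ρ) = fun col : Fin r =>
      if (col : ℕ) < windowStart i then 0
      else C (blockEntry κ i (fun s : Fin t => Y (n + (s : ℕ))) ρ (col : ℕ)) * X ^ (col : ℕ) := by
  funext col
  by_cases hq : (ρ.2 : ℕ) < i
  · rw [blockLabel_of_lt ρ hq, blockEntry, if_pos hq]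
    simp [kblockReducedRow]
  · rw [blockLabel_of_not_lt ρ hq, blockEntry, if_neg hq]
    have e : n + ((ρ.2 : ℕ) - i) = n + ((⟨(ρ.2 : ℕ) - i, by have := ρ.2.2; have := ρ.1.2; omega⟩ : Fin t) : ℕ) := rfl
    simp [kblockReducedRow]

/-- Reduced external rows. -/
theorem kblockReducedRow_extLabel (cs : Fin n × Fin t) :
    kblockReducedRow κ r i n Y (extLabel n cs) = fun col : Fin r =>
      ∑ d ∈ (bits (col : ℕ)).powerset.filter (fun d => i ≤ bin d),
        C ((((κ (bits (col : ℕ) \ d).card : ℕ) : R)) * Y (cs.1 : ℕ) ^ bin (bits (col : ℕ) \ d) *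
          (((κ d.card : ℕ) : R) * Y (n + (cs.2 : ℕ)) ^ bin d)) * X ^ bin d := by
  funext col
  have h1 : ¬ n ≤ (cs.1 : ℕ) := not_le.mpr cs.1.2
  simp [kblockReducedRow, extLabel, h1]

end Reduced

end Summit.ValiantsHypothesis.ValiantsHypothesis.Theorems.BarrierLever.MoorePeel
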